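import Mathlib
import Literature.MathematicalPhysics.QuantumFieldTheory.Balaban1983to89.B14Eq356FieldStrength

/-!
# `Balaban1983to89.B14.Eq350Kernel` — [Balaban1988Convergent] (3.49)/(3.50) p. 280: the Taylor coefficients
# `⟨𝐄^{(n)}(X,z), ⊗ⁿB⟩` of the localized effective-action terms in the background field `B`, the second-derivative
# kernel `𝐄^{(2)}_{μν}(X,x,y,z)` (3.50), and the sentence "This implies 𝐄^{(2)}_{μν}(X,x,y,z) = 𝐄^{(2)}_{νμ}(X,y,x,z)" PROVED

statement-level skeleton of published theorems with citation tags; proofs where landed; nothing here is a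
claim about the Yang–Mills mass gap

PDF held: `paper:balaban1988-cmp119-convergent-renormalization` (journal page = PDF page + 242); (3.49)–(3.51) read on the
x2 render `…-p038-x2.png` (p. 280) and (3.55)–(3.56) on `…-p039-x2.png` (p. 281) of
`run/shared/lean/pub/pub-balaban/b2b-balaban-ref1/pages/1988-cmp119-convergent-renormalization/`.

CITATION HEADER (lean-in-tree rule).  Source: T. Bałaban, *Convergent renormalization expansions for lattice gauge
theories*, Commun. Math. Phys. **119**, 243–285 (1988), doi:10.1007/bf01217741 [Balaban1988Convergent] (cell paper B14 =
"[III]").  Mega-formalization `lit-balaban` (HOME `run/shared/lean/pub/lit-balaban/`), reader/typer unit `lit-balaban-r11`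
(generation 3), SKELETON row **B14.Eq3.49–3.50** (decls of record so far: the ABSTRACT pairing algebra of
`…B14Sect3` §Antisymmetrization and the printed objects of (3.49)/(3.56) at a point in `…B14.Eq356FieldStrength`
(`halfTerm`, `pairTrace`, `moment2`, `eq356`); the display (3.49) and the definition (3.50) themselves were absent).

THE PRINTED TEXT (verbatim, p. 280 [PDF 38]).  *"To the sum on the right-hand side (I.3.34) we apply the considerations of
Sect. 4 [I], with two differences only. We do not differentiate with respect to t_□ yet, hence all the factors B in the
sum are the same, and applying the Ward-Takahashi identities (I.4.14), (I.4.15), and other operations of that section, we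
move the factors B to the point z instead of the point x. The final formula we obtain is slightly different from the
formula (I.4.34). We have
  Σ_{n=1}^{4} (1/n!) ⟨𝐄^{(n)}(X, z), ⊗ⁿ B⟩ = Σ_{μ,ν,κ,λ} [Σ_{x,y} 𝐄^{(2)}_{μν}(X, x, y, z)(x_κ − z_κ)(y_λ − z_λ)]
      · ½ tr((∂_κB_μ)(z) + ½ i[B_κ(z), B_μ(z)])((∂_λB_ν)(z) + ½ i[B_λ(z), B_ν(z)]) + (the irrelevant terms)   (3.49)
As in Sect. 4 [I] we have dropped the superscript (j) in the symbols above, the superscripts written denote the functional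
derivatives with respect to B. In particular
  𝐄^{(2)}_{μν}(X, x, y, z) = δ²/(δB_μ(x)δB_ν(y)) 𝐄^{(j)}(X, U_j(exp iB), z)|_{B=0} .   (3.50)
This implies 𝐄^{(2)}_{μν}(X, x, y, z) = 𝐄^{(2)}_{νμ}(X, y, x, z)."*  And p. 281 [PDF 39]: *"Let us recall that (the irrelevant
terms) above, and in (3.49), denotes the sum of terms which can be bounded by O((LʲL⁻ⁿ)^{5−β}) exp(−κd_j(X)), where β is a
positive number."*

THE MODEL.  The map `B ↦ 𝐄^{(j)}(X, U_j(exp iB), z)` — a real function of the background vector field `B = (B_μ(x))`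
on the finitely many bonds `⟨x, x+e_μ⟩`, `(μ, x) ∈ ι`, that enter the localized term — is an ABSTRACT function
`F : (ι → 𝔤) → ℝ` on the configuration space `ι → 𝔤`, `𝔤` any real normed space (the Lie algebra; `𝔤 = ℝ` for scalar
field components).  Neither `𝐄^{(j)}`, nor `U_j`, nor `exp iB` is modelled: only the composite `F`, whose functional
derivatives at `B = 0` the print takes.  "Functional derivative with respect to B_μ(x)" = the Fréchet derivative in the
coordinate direction `Pi.single (μ,x)`; `⟨𝐄^{(n)}(X,z), ⊗ⁿB⟩` = the `n`-th Fréchet derivative at `0` evaluated on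
`(B, …, B)` (Mathlib `iteratedFDeriv ℝ n F 0`).  For a general 𝔤 the second derivative in two coordinate directions is a
bilinear form on `𝔤` (`E2 F i j a b`); the print's SCALAR kernel `𝐄^{(2)}_{μν}(X,x,y,z)` is its value for scalar components
(`kernel350`, `𝔤 = ℝ`, `a = b = 1`) — for matrix-valued `B` the print tacitly reads the invariant bilinear form as a scalar
multiple of the trace form (the `tr` in (3.49)); that identification is representation theory of the gauge group and is
NOT typed here (the scalar table `K` in §3 is a free datum).

WHAT IS TYPED (definitions with bodies):
* `dTensor F n B` = `⟨𝐄^{(n)}(X,z), ⊗ⁿB⟩`; `taylor4 F B` = the left-hand side of (3.49), `Σ_{n=1}^{4} (1/n!) ⟨𝐄^{(n)}, ⊗ⁿB⟩`;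
* `E1 F i a`, `E2 F i j a b` — first and second functional derivatives at `B = 0` in coordinate directions (general 𝔤);
  `kernel350 F μ ν x y` — **(3.50)** for scalar components, `ι = Fin d × X`;
* `valueAt`, `fwdDerivAt` — the readers `B_μ(z)`, `(∂_κB_μ)(z) = η⁻¹(B_μ(z + ηe_κ) − B_μ(z))` of a bond field at the point z;
* `main349 K s coord z dB Bz` — the displayed main term of (3.49) for a scalar kernel table `K μ ν x y` = 𝐄^{(2)}_{μν}(X,x,y,z)
  over a finite window `s` of pairs `(x, y)`: `Σ_{μ,ν,κ,λ} moment2 · pairTrace` in the vocabulary of `…B14.Eq356FieldStrength`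
  (`moment2 s K coord z μ ν κ λ = Σ_{(x,y)∈s} K_{μν}(x,y)(x_κ − z_κ)(y_λ − z_λ)`, `pairTrace dB Bz κ μ λ ν = ½ Re tr M_{κμ}M_{λν}`);
* `Eq349 F B K s coord z dB Bz R : Prop` — the display (3.49) with an EXPLICIT irrelevant term `R` (the print defines
  "(the irrelevant terms)" only through its bound, p. 281; the bound is NOT typed — it is the content of Sects. 3–4 of [I]
  by reference, rows B12.Eq3.3–3.35, B12.Eq4.14–4.34).
WHAT IS PROVED: `E2_symm` / **`kernel350_symm`** — *"This implies 𝐄^{(2)}_{μν}(X,x,y,z) = 𝐄^{(2)}_{νμ}(X,y,x,z)"* for `F`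
twice continuously differentiable at `0` (symmetry of the second derivative, Mathlib `ContDiffAt.isSymmSndFDerivAt`);
`dTensor_one`, **`dTensor_two`** (`⟨𝐄^{(2)}, B ⊗ B⟩ = Σ_{i,j} E2 F i j (B i) (B j)` — the n = 2 Taylor
coefficient IS the kernel sum, by bilinearity over `B = Σ_i Pi.single i (B i)`), `E2_real`, `dTensor_two_scalar` (scalar
components: `⟨𝐄^{(2)}, B ⊗ B⟩ = Σ_{(μ,x),(ν,y)} 𝐄^{(2)}_{μν}(x,y) B_μ(x) B_ν(y)`), `taylor4_eq` (the four terms spelled out), and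
**`eq356_of_eq349`** — (3.49) + the antisymmetries (3.55) of the moment table ⇒ (3.56) WITH THE PRINTED LEFT-HAND SIDE
`Σ_{n=1}^{4} (1/n!)⟨𝐄^{(n)}(X,z), ⊗ⁿB⟩ = Σ_{κ<μ,λ<ν} ½ 𝐄^{(2)}_{μν,κλ}(X,z) tr F_{κμ}(z)F_{λν}(z) + R` (instantiating
`…B14.Eq356FieldStrength.eq356`).
NOT HERE: that (3.49) HOLDS for Bałaban's functions (the Ward–Takahashi manipulations of Sect. 4 [I] moving `B` to the
point `z`); the bound on the irrelevant terms; (3.51)–(3.55) (row B14.Lem@280, `…B14Sect3.sum_antisymm_pair` &c.); the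
trace-form reading of the bilinear kernel for matrix-valued fields.  No `sorry`.  §3 puts Mathlib's `L^∞`-operator norm
on square matrices as a LOCAL instance (`Matrix.linftyOpNormedAddCommGroup` / `…NormedSpace`) only to speak of Fréchet
derivatives of a function of a matrix-valued bond field; nothing depends on the choice of (equivalent) norm.
-/

open Finset

namespace Literature.MathematicalPhysics.QuantumFieldTheory.Balaban1983to89.B14.Eq350Kernel

/-! ## §1. Functional derivatives at `B = 0` of a function of the bond field (general Lie-algebra-valued components) -/

section General

variable {ι : Type*} [Fintype ι] [DecidableEq ι] {𝔤 : Type*} [NormedAddCommGroup 𝔤] [NormedSpace ℝ 𝔤]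

/-- `⟨𝐄^{(n)}(X, z), ⊗ⁿ B⟩`: the `n`-th functional (Fréchet) derivative of `F = [B ↦ 𝐄^{(j)}(X, U_j(exp iB), z)]` at `B = 0`,
evaluated on the constant `n`-tuple `(B, …, B)`. [cite: Balaban1988Convergent, (3.49) p.280] -/
noncomputable def dTensor (F : (ι → 𝔤) → ℝ) (n : ℕ) (B : ι → 𝔤) : ℝ :=
  iteratedFDeriv ℝ n F 0 (fun _ => B)

/-- The left-hand side of (3.49): `Σ_{n=1}^{4} (1/n!) ⟨𝐄^{(n)}(X, z), ⊗ⁿ B⟩` — the fourth-order Taylor polynomial of `F` at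
`B = 0` without its constant term. [cite: Balaban1988Convergent, (3.49) p.280] -/
noncomputable def taylor4 (F : (ι → 𝔤) → ℝ) (B : ι → 𝔤) : ℝ :=
  ∑ n ∈ Icc 1 4, ((n.factorial : ℕ) : ℝ)⁻¹ * dTensor F n B

/-- First functional derivative at `B = 0` in the coordinate direction `i = (μ, x)`: `δF/δB_μ(x)|_{B=0}` applied to `a ∈ 𝔤`.
[cite: Balaban1988Convergent, (3.49)–(3.50) p.280] -/
noncomputable def E1 (F : (ι → 𝔤) → ℝ) (i : ι) (a : 𝔤) : ℝ :=
  fderiv ℝ F 0 (Pi.single i a)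

/-- **(3.50), general components**: `δ²F/(δB_i δB_j)|_{B=0}` as a bilinear form on `𝔤`, `i = (μ, x)`, `j = (ν, y)` — the second
Fréchet derivative of `F` at `0` on the coordinate directions `Pi.single i a`, `Pi.single j b`.
[cite: Balaban1988Convergent, (3.50) p.280] -/
noncomputable def E2 (F : (ι → 𝔤) → ℝ) (i j : ι) (a b : 𝔤) : ℝ :=
  fderiv ℝ (fderiv ℝ F) 0 (Pi.single i a) (Pi.single j b)

/-- `E2` is the second Taylor coefficient read on coordinate directions: `E2 F i j a b = D²F(0)[single i a, single j b]`.
[cite: Balaban1988Convergent, (3.50) p.280] -/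
theorem E2_eq_iteratedFDeriv (F : (ι → 𝔤) → ℝ) (i j : ι) (a b : 𝔤) :
    E2 F i j a b = iteratedFDeriv ℝ 2 F 0 ![Pi.single i a, Pi.single j b] := by
  rw [iteratedFDeriv_two_apply]
  rfl

/-- **"This implies 𝐄^{(2)}_{μν}(X, x, y, z) = 𝐄^{(2)}_{νμ}(X, y, x, z)"** (p. 280, after (3.50)), general components: for `F`
twice continuously differentiable at `B = 0` the second functional derivative is symmetric under `(i, a) ↔ (j, b)`
(Schwarz; Mathlib `ContDiffAt.isSymmSndFDerivAt`). [cite: Balaban1988Convergent, (3.50) p.280] -/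
theorem E2_symm {F : (ι → 𝔤) → ℝ} (hF : ContDiffAt ℝ 2 F 0) (i j : ι) (a b : 𝔤) :
    E2 F i j a b = E2 F j i b a :=
  (hF.isSymmSndFDerivAt (by simp)) (Pi.single i a) (Pi.single j b)

/-- Bilinear bookkeeping on the finite configuration space: a continuous bilinear form evaluated on `(v, w)` is the double
sum of its values on the coordinate components, `L v w = Σ_{i,j} L (single i (v i)) (single j (w j))`. [folklore] -/
private theorem bilin_apply_eq_sum (L : (ι → 𝔤) →L[ℝ] (ι → 𝔤) →L[ℝ] ℝ) (v w : ι → 𝔤) :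
    L v w = ∑ i, ∑ j, L (Pi.single i (v i)) (Pi.single j (w j)) := by
  have hv : (∑ i, Pi.single i (v i)) = v := Finset.univ_sum_single v
  have hw : (∑ j, Pi.single j (w j)) = w := Finset.univ_sum_single w
  calc L v w = L (∑ i, Pi.single i (v i)) w := by rw [hv]
    _ = ∑ i, L (Pi.single i (v i)) w := by
        rw [map_sum, FunLike.coe_sum, Finset.sum_apply]
    _ = ∑ i, ∑ j, L (Pi.single i (v i)) (Pi.single j (w j)) :=
        Finset.sum_congr rfl fun i _ => by
          conv_lhs => rw [← hw]
          rw [map_sum]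

/-- The `n = 1` term of (3.49): `⟨𝐄^{(1)}(X,z), B⟩ = Σ_i δF/δB_i|_0 (B i)`. [cite: Balaban1988Convergent, (3.49) p.280] -/
theorem dTensor_one (F : (ι → 𝔤) → ℝ) (B : ι → 𝔤) : dTensor F 1 B = ∑ i, E1 F i (B i) := by
  simp only [dTensor, E1, iteratedFDeriv_one_apply]
  conv_lhs => rw [← Finset.univ_sum_single B]
  rw [map_sum]

/-- **The `n = 2` term of (3.49) is the kernel sum**: `⟨𝐄^{(2)}(X,z), B ⊗ B⟩ = Σ_{i,j} δ²F/(δB_iδB_j)|_0 (B i, B j)`.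
[cite: Balaban1988Convergent, (3.49)–(3.50) p.280] -/
theorem dTensor_two (F : (ι → 𝔤) → ℝ) (B : ι → 𝔤) : dTensor F 2 B = ∑ i, ∑ j, E2 F i j (B i) (B j) := by
  simp only [dTensor, E2, iteratedFDeriv_two_apply]
  exact bilin_apply_eq_sum _ B B

omit [DecidableEq ι] in
/-- The four terms of the left-hand side of (3.49) spelled out:
`⟨𝐄^{(1)},B⟩ + ½⟨𝐄^{(2)},B⊗B⟩ + (1/6)⟨𝐄^{(3)},⊗³B⟩ + (1/24)⟨𝐄^{(4)},⊗⁴B⟩`. [cite: Balaban1988Convergent, (3.49) p.280] -/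
theorem taylor4_eq (F : (ι → 𝔤) → ℝ) (B : ι → 𝔤) :
    taylor4 F B = dTensor F 1 B + (1/2 : ℝ) * dTensor F 2 B + (1/6 : ℝ) * dTensor F 3 B
      + (1/24 : ℝ) * dTensor F 4 B := by
  have h : Icc 1 4 = ({1, 2, 3, 4} : Finset ℕ) := by decide
  rw [taylor4, h]
  simp [Finset.sum_insert, Nat.factorial]
  ring

end General

/-! ## §2. (3.50) for scalar field components: the printed scalar kernel `𝐄^{(2)}_{μν}(X, x, y, z)` -/

section Scalar

variable {d : ℕ} {X : Type*} [Fintype X] [DecidableEq X]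

/-- For scalar components the bilinear form `E2 F i j` on `ℝ` is multiplication by its value at `(1, 1)`.
[cite: Balaban1988Convergent, (3.50) p.280] -/
theorem E2_real {ι : Type*} [Fintype ι] [DecidableEq ι] (F : (ι → ℝ) → ℝ) (i j : ι) (a b : ℝ) :
    E2 F i j a b = a * b * E2 F i j 1 1 := by
  simp only [E2]
  have ha : (Pi.single i a : ι → ℝ) = a • Pi.single i (1 : ℝ) := by
    rw [← Pi.single_smul, smul_eq_mul, mul_one]
  have hb : (Pi.single j b : ι → ℝ) = b • Pi.single j (1 : ℝ) := by
    rw [← Pi.single_smul, smul_eq_mul, mul_one]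
  rw [ha, hb]
  simp only [map_smul, FunLike.coe_smul, Pi.smul_apply, smul_eq_mul]
  ring

/-- **(3.50)** (verbatim shape, scalar field components on the bonds `⟨x, x+e_μ⟩`, `(μ, x) ∈ Fin d × X`):
`𝐄^{(2)}_{μν}(X, x, y, z) = δ²/(δB_μ(x)δB_ν(y)) F(B)|_{B=0}`, `F(B) = 𝐄^{(j)}(X, U_j(exp iB), z)`.
[cite: Balaban1988Convergent, (3.50) p.280] -/
noncomputable def kernel350 (F : (Fin d × X → ℝ) → ℝ) (μ ν : Fin d) (x y : X) : ℝ :=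
  E2 F (μ, x) (ν, y) 1 1

/-- **"This implies 𝐄^{(2)}_{μν}(X, x, y, z) = 𝐄^{(2)}_{νμ}(X, y, x, z)."** (p. 280), for `F` twice continuously differentiable at
`B = 0`. [cite: Balaban1988Convergent, (3.50) p.280] -/
theorem kernel350_symm {F : (Fin d × X → ℝ) → ℝ} (hF : ContDiffAt ℝ 2 F 0) (μ ν : Fin d) (x y : X) :
    kernel350 F μ ν x y = kernel350 F ν μ y x :=
  E2_symm hF (μ, x) (ν, y) 1 1

/-- The `n = 2` Taylor term for scalar components: `⟨𝐄^{(2)}(X,z), B⊗B⟩ = Σ_{(μ,x),(ν,y)} 𝐄^{(2)}_{μν}(X,x,y,z) B_μ(x) B_ν(y)`.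
[cite: Balaban1988Convergent, (3.49)–(3.50) p.280] -/
theorem dTensor_two_scalar (F : (Fin d × X → ℝ) → ℝ) (B : Fin d × X → ℝ) :
    dTensor F 2 B = ∑ p, ∑ q, kernel350 F p.1 q.1 p.2 q.2 * (B p * B q) := by
  rw [dTensor_two]
  refine Finset.sum_congr rfl fun p _ => Finset.sum_congr rfl fun q _ => ?_
  rw [E2_real, kernel350]
  ring

end Scalar

/-! ## §3. The display (3.49) over the printed objects of `B14.Eq356FieldStrength`, and (3.49) + (3.55) ⇒ (3.56) -/

section Display349

variable {d : ℕ} {X : Type*} {m : Type*} [Fintype m]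

/-- The reader `B_μ(z)` of a bond field `B` (components `B (μ, x)` on the bonds `⟨x, x+e_μ⟩`) at the point `z`.
[cite: Balaban1988Convergent, (3.49) p.280] -/
def valueAt {𝔤 : Type*} (B : Fin d × X → 𝔤) (z : X) (μ : Fin d) : 𝔤 := B (μ, z)

/-- The reader `(∂_κB_μ)(z) = η⁻¹ (B_μ(z + ηe_κ) − B_μ(z))` (forward lattice difference quotient on a lattice of spacing `η`,
`shift κ z = z + ηe_κ`). [cite: Balaban1988Convergent, (3.49) p.280] -/
noncomputable def fwdDerivAt {𝔤 : Type*} [AddCommGroup 𝔤] [Module ℝ 𝔤] (η : ℝ) (shift : Fin d → X → X)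
    (B : Fin d × X → 𝔤) (z : X) (κ μ : Fin d) : 𝔤 :=
  η⁻¹ • (B (μ, shift κ z) - B (μ, z))

/-- The main (second-order, marginal) term displayed in (3.49):
`Σ_{μ,ν,κ,λ} [Σ_{(x,y)∈s} K_{μν}(x, y)(x_κ − z_κ)(y_λ − z_λ)] · ½ tr((∂_κB_μ)(z) + ½i[B_κ(z),B_μ(z)])((∂_λB_ν)(z) + ½i[B_λ(z),B_ν(z)])`
for a scalar kernel table `K μ ν x y` (= `𝐄^{(2)}_{μν}(X, x, y, z)`) over a finite window `s` of pairs, coordinates `coord`,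
with `dB κ μ = (∂_κB_μ)(z)`, `Bz μ = B_μ(z)` (real part of the trace, as in `B14.Eq356FieldStrength.pairTrace`).
[cite: Balaban1988Convergent, (3.49) p.280] -/
noncomputable def main349 (K : Fin d → Fin d → X → X → ℝ) (s : Finset (X × X)) (coord : X → Fin d → ℝ) (z : X)
    (dB : Fin d → Fin d → Matrix m m ℂ) (Bz : Fin d → Matrix m m ℂ) : ℝ :=
  ∑ μ, ∑ ν, ∑ κ, ∑ τ, Eq356FieldStrength.moment2 s K coord z μ ν κ τ * Eq356FieldStrength.pairTrace dB Bz κ μ τ ν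

attribute [local instance] Matrix.linftyOpNormedAddCommGroup Matrix.linftyOpNormedSpace

/-- **(3.49) as a statement**, for a function `F` of the matrix-valued bond field, a scalar kernel table `K`, the readers
`dB`, `Bz` of the field at `z` (intended: `fwdDerivAt η shift B z`, `valueAt B z`) and an explicit irrelevant term `R`:
`Σ_{n=1}^{4} (1/n!)⟨𝐄^{(n)}(X,z), ⊗ⁿB⟩ = main349 K s coord z dB Bz + R`.  (The print characterizes "(the irrelevant terms)"
only by the bound `O((LʲL⁻ⁿ)^{5−β}) exp(−κd_j(X))`, p. 281 — not typed.) [cite: Balaban1988Convergent, (3.49) p.280] -/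
def Eq349 [Fintype X] (F : (Fin d × X → Matrix m m ℂ) → ℝ) (B : Fin d × X → Matrix m m ℂ)
    (K : Fin d → Fin d → X → X → ℝ)
    (s : Finset (X × X)) (coord : X → Fin d → ℝ) (z : X) (dB : Fin d → Fin d → Matrix m m ℂ)
    (Bz : Fin d → Matrix m m ℂ) (R : ℝ) : Prop :=
  taylor4 F B = main349 K s coord z dB Bz + R

/-- **(3.49) + (3.55) ⇒ (3.56) with the printed left-hand side**: if (3.49) holds with irrelevant term `R` and the moment
table `𝐄^{(2)}_{μν,κλ}(X,z) = Σ_{x,y} K_{μν}(x,y)(x_κ − z_κ)(y_λ − z_λ)` has the antisymmetries (3.55), then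
`Σ_{n=1}^{4} (1/n!)⟨𝐄^{(n)}(X,z), ⊗ⁿB⟩ = Σ_{κ<μ, λ<ν} ½ 𝐄^{(2)}_{μν,κλ}(X,z) tr F_{κμ}(z)F_{λν}(z) + R`
(`B14.Eq356FieldStrength.expr356`, via `eq356`). [cite: Balaban1988Convergent, (3.49) p.280; (3.55)–(3.56) p.281] -/
theorem eq356_of_eq349 [Fintype X] {F : (Fin d × X → Matrix m m ℂ) → ℝ} {B : Fin d × X → Matrix m m ℂ}
    {K : Fin d → Fin d → X → X → ℝ} {s : Finset (X × X)} {coord : X → Fin d → ℝ} {z : X}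
    {dB : Fin d → Fin d → Matrix m m ℂ} {Bz : Fin d → Matrix m m ℂ} {R : ℝ}
    (h349 : Eq349 F B K s coord z dB Bz R)
    (h355a : ∀ μ ν κ τ, Eq356FieldStrength.moment2 s K coord z μ ν κ τ
      = -Eq356FieldStrength.moment2 s K coord z κ ν μ τ)
    (h355b : ∀ μ ν κ τ, Eq356FieldStrength.moment2 s K coord z μ ν κ τ
      = -Eq356FieldStrength.moment2 s K coord z μ τ κ ν) :
    taylor4 F B = Eq356FieldStrength.expr356 (Eq356FieldStrength.moment2 s K coord z) dB Bz + R := by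
  rw [h349, main349, Eq356FieldStrength.eq356 _ h355a h355b]

end Display349

end Literature.MathematicalPhysics.QuantumFieldTheory.Balaban1983to89.B14.Eq350Kernel
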